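import Summits.QuantumAdvantage.QuantumAdvantage.Theses.WildDial
import Summits.QuantumAdvantage.QuantumAdvantage.Theorems.RingPeriodFoldStrategies
import HarnessLib

/-!
# The LENGTH DICHOTOMY of the door item 33109 `WildDial.CovHard3` (supports stmt-QuantumAdvantage-33109)

Cell decomp-qadv, seat lens-2, generation 12, node `LeaderDial` §5 (critic rows 57 / 57v3).  No new `Prop`: the three
length pieces are spelled out as hypotheses / conjuncts.

`WildDial.CovHard3 : ∀ D, ∃ n₀, ∀ n ≥ n₀, n ∈ covLosing D` (no rotation-covariant `𝔽₃` rule of constant degree is perfect on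
the odd class of any long ring).  Writing a length as `n = 2^a·u` (`u` odd) and using the tree's FOLD AMPLIFIER
`RingPeriodFold.covNotPerfectAt_mul` (`d ∈ covLosing D`, `m` odd, `d ≥ 3` ⟹ `m·d ∈ covLosing D`), the door is EQUIVALENT
(`covHard3_iff_lengths`) to the conjunction of
* POWERS OF TWO: `∀ D, ∃ a₀, ∀ a ≥ a₀, 2^a ∈ covLosing D`;
* THE FOLD-FREE CORE: `∀ D a, ∃ p₀, ∀ p ≥ p₀, p.Prime → 2^a·p ∈ covLosing D`;
* THE SMOOTH NET: every large odd `P`-smooth cofactor `u` has a divisor `v` with `2^a·v ≥ 3` a losing length —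
and the smooth net follows from FINITELY MANY CERTIFICATES per `(D, a, P)`: one losing length `2^a·p^j` per odd prime
`p` (`smoothNet_of_certificates`, by the prime-factorisation bound `u ≤ ∏_{p<P} p^{j(p)}`), whence
`covHard3_iff_certificates`.  This sharpens the tree law `RingPeriodFold.covNotPerfect_iff_irr` (relative irreducibility)
into an absolute arithmetic normal form: the door need only be won at the fold-free lengths `2^a` and `2^a·p`, plus one
certified prime power per small odd prime.
-/

set_option linter.dupNamespace false

noncomputable section

open scoped Classical

namespace Summit.QuantumAdvantage.QuantumAdvantage.Theorems

open Finset
open Summit.QuantumAdvantage.QuantumAdvantage.Theses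
open Summit.QuantumAdvantage.QuantumAdvantage.Theorems.RingPeriodFold (covLosing covNotPerfectAt_mul)

/-- NECESSITY: the door restricted to the powers of two, to the prime multiples of each power of two, and (with `v := u`)
the smooth net. -/
theorem lengths_of_covHard3 (h : WildDial.CovHard3) :
    (∀ D : ℕ, ∃ a₀ : ℕ, ∀ a ≥ a₀, 2 ^ a ∈ covLosing D) ∧
    (∀ D a : ℕ, ∃ p₀ : ℕ, ∀ p ≥ p₀, p.Prime → 2 ^ a * p ∈ covLosing D) ∧
    (∀ D a P : ℕ, ∃ u₀ : ℕ, ∀ u ≥ u₀, Odd u → (∀ p : ℕ, p.Prime → p ∣ u → p < P) →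
      ∃ v : ℕ, v ∣ u ∧ 3 ≤ 2 ^ a * v ∧ 2 ^ a * v ∈ covLosing D) := by
  refine ⟨fun D => ?_, fun D a => ?_, fun D a P => ?_⟩
  · obtain ⟨n₀, hn⟩ := h D
    exact ⟨n₀, fun a ha => hn _ (le_trans ha Nat.lt_two_pow_self.le)⟩
  · obtain ⟨n₀, hn⟩ := h D
    exact ⟨n₀, fun p hp _ => hn _ (le_trans hp (Nat.le_mul_of_pos_left p (Nat.two_pow_pos a)))⟩
  · obtain ⟨n₀, hn⟩ := h D
    refine ⟨max n₀ 3, fun u hu _ _ => ⟨u, dvd_rfl, ?_, hn _ ?_⟩⟩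
    · exact le_trans (le_trans (le_max_right _ _) hu) (Nat.le_mul_of_pos_left u (Nat.two_pow_pos a))
    · exact le_trans (le_trans (le_max_left _ _) hu) (Nat.le_mul_of_pos_left u (Nat.two_pow_pos a))

/-- NECESSITY of the certificates: the door gives, for every `a` and odd prime `p`, a losing length `2^a·p^j ≥ 3`
(`j := n₀ + 1`). -/
theorem certificates_of_covHard3 (h : WildDial.CovHard3) :
    ∀ D a p : ℕ, p.Prime → p ≠ 2 → ∃ j : ℕ, 3 ≤ 2 ^ a * p ^ j ∧ 2 ^ a * p ^ j ∈ covLosing D := by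
  intro D a p hp hp2
  obtain ⟨n₀, hn⟩ := h D
  have hp3 : 3 ≤ p := by have := hp.two_le; omega
  have h1 : p ≤ p ^ (n₀ + 1) := by
    calc p = p ^ 1 := (pow_one p).symm
      _ ≤ p ^ (n₀ + 1) := Nat.pow_le_pow_right hp.pos (by omega)
  have h2 : n₀ + 1 < p ^ (n₀ + 1) := Nat.lt_pow_self (by omega)
  have h3 : p ^ (n₀ + 1) ≤ 2 ^ a * p ^ (n₀ + 1) := Nat.le_mul_of_pos_left _ (Nat.two_pow_pos a)
  exact ⟨n₀ + 1, by omega, hn _ (by omega)⟩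

/-- **EXHAUSTION (the length dichotomy).** Powers of two + the fold-free core + the smooth net ⟹ the door: write
`n = 2^a·u` (`u` odd); for `a ≥ A := max a₀ 2` fold onto `2^a`; otherwise `u` either has a prime factor `p ≥ p₀(a)` (fold
onto `2^a·p`) or is `p₀(a)`-smooth (fold onto a net length).  Threshold `2^A·(Σ_{a<A} u₀(a) + 1)`. -/
theorem covHard3_of_lengths
    (h2 : ∀ D : ℕ, ∃ a₀ : ℕ, ∀ a ≥ a₀, 2 ^ a ∈ covLosing D)
    (hP : ∀ D a : ℕ, ∃ p₀ : ℕ, ∀ p ≥ p₀, p.Prime → 2 ^ a * p ∈ covLosing D)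
    (hS : ∀ D a P : ℕ, ∃ u₀ : ℕ, ∀ u ≥ u₀, Odd u → (∀ p : ℕ, p.Prime → p ∣ u → p < P) →
      ∃ v : ℕ, v ∣ u ∧ 3 ≤ 2 ^ a * v ∧ 2 ^ a * v ∈ covLosing D) :
    WildDial.CovHard3 := by
  intro D
  obtain ⟨a₀, ha₀⟩ := h2 D
  choose p₀ hp₀ using hP D
  choose u₀ hu₀ using fun a => hS D a (p₀ a)
  set A := max a₀ 2 with hA
  set M := (Finset.range A).sum u₀ + 1 with hM
  refine ⟨2 ^ A * M, fun n hn => ?_⟩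
  have hAM : 1 ≤ 2 ^ A * M := Nat.le_mul_of_pos_left M (Nat.two_pow_pos A) |>.trans' (by omega)
  have hn0 : n ≠ 0 := by omega
  obtain ⟨a, u, hu, rfl⟩ := Nat.exists_eq_two_pow_mul_odd hn0
  by_cases ha : A ≤ a
  · have hl : 2 ^ a ∈ covLosing D := ha₀ a (le_trans (le_max_left _ _) ha)
    have h3 : 3 ≤ 2 ^ a :=
      le_trans (by norm_num) (Nat.pow_le_pow_right (by norm_num) (le_trans (le_max_right a₀ 2) ha))
    rw [mul_comm]
    exact covNotPerfectAt_mul hu h3 hl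
  · push Not at ha
    have huM : u₀ a ≤ u := by
      have h1 : u₀ a ≤ (Finset.range A).sum u₀ :=
        Finset.single_le_sum (f := u₀) (fun _ _ => Nat.zero_le _) (Finset.mem_range.mpr ha)
      have h2 : 2 ^ a * M ≤ 2 ^ a * u :=
        le_trans (Nat.mul_le_mul_right _ (Nat.pow_le_pow_right (by norm_num) ha.le)) hn
      have h3 := Nat.le_of_mul_le_mul_left h2 (Nat.two_pow_pos a)
      omega
    by_cases hbig : ∃ p : ℕ, p.Prime ∧ p ∣ u ∧ p₀ a ≤ p
    · obtain ⟨p, hp, hpu, hpp⟩ := hbig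
      have hl : 2 ^ a * p ∈ covLosing D := hp₀ a p hpp hp
      have hp3 : 3 ≤ p := by
        have h2 := hp.two_le
        have hne : p ≠ 2 := by
          rintro rfl
          exact (Nat.not_even_iff_odd.mpr hu) (even_iff_two_dvd.mpr hpu)
        omega
      have h3 : 3 ≤ 2 ^ a * p := le_trans hp3 (Nat.le_mul_of_pos_left p (Nat.two_pow_pos a))
      obtain ⟨w, rfl⟩ := hpu
      have hw : Odd w := (Nat.odd_mul.mp hu).2
      rw [show 2 ^ a * (p * w) = w * (2 ^ a * p) by ring]
      exact covNotPerfectAt_mul hw h3 hl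
    · push Not at hbig
      obtain ⟨v, hvu, h3, hl⟩ := hu₀ a u huM hu (fun p hp hpu => hbig p hp hpu)
      obtain ⟨w, rfl⟩ := hvu
      have hw : Odd w := (Nat.odd_mul.mp hu).2
      rw [show 2 ^ a * (v * w) = w * (2 ^ a * v) by ring]
      exact covNotPerfectAt_mul hw h3 hl

/-- **THE DOOR ⟺ ITS THREE LENGTH PIECES** (powers of two ∧ fold-free core ∧ smooth net). -/
theorem covHard3_iff_lengths :
    WildDial.CovHard3 ↔
    (∀ D : ℕ, ∃ a₀ : ℕ, ∀ a ≥ a₀, 2 ^ a ∈ covLosing D) ∧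
    (∀ D a : ℕ, ∃ p₀ : ℕ, ∀ p ≥ p₀, p.Prime → 2 ^ a * p ∈ covLosing D) ∧
    (∀ D a P : ℕ, ∃ u₀ : ℕ, ∀ u ≥ u₀, Odd u → (∀ p : ℕ, p.Prime → p ∣ u → p < P) →
      ∃ v : ℕ, v ∣ u ∧ 3 ≤ 2 ^ a * v ∧ 2 ^ a * v ∈ covLosing D) :=
  ⟨lengths_of_covHard3, fun h => covHard3_of_lengths h.1 h.2.1 h.2.2⟩

/-- **THE SMOOTH NET FROM FINITELY MANY CERTIFICATES**: if every `(a, p)` (`p` an odd prime) has SOME losing length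
`2^a·p^j ≥ 3`, then every large odd `P`-smooth `u` has a divisor `v` with `2^a·v` losing — an odd `P`-smooth `u` exceeding
`∏_{p<P, p odd prime} p^{j(p)}` is divisible by a certified `p^{j(p)}` (prime-factorisation bound). -/
theorem smoothNet_of_certificates
    (h : ∀ D a p : ℕ, p.Prime → p ≠ 2 → ∃ j : ℕ, 3 ≤ 2 ^ a * p ^ j ∧ 2 ^ a * p ^ j ∈ covLosing D) :
    ∀ D a P : ℕ, ∃ u₀ : ℕ, ∀ u ≥ u₀, Odd u → (∀ p : ℕ, p.Prime → p ∣ u → p < P) →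
      ∃ v : ℕ, v ∣ u ∧ 3 ≤ 2 ^ a * v ∧ 2 ^ a * v ∈ covLosing D := by
  intro D a P
  have hq : ∀ p : ℕ, ∃ j : ℕ, p.Prime → p ≠ 2 → 3 ≤ 2 ^ a * p ^ j ∧ 2 ^ a * p ^ j ∈ covLosing D := by
    intro p
    by_cases hp : p.Prime ∧ p ≠ 2
    · obtain ⟨j, hj⟩ := h D a p hp.1 hp.2
      exact ⟨j, fun _ _ => hj⟩
    · exact ⟨0, fun h1 h2 => (hp ⟨h1, h2⟩).elim⟩
  choose J hJ using hq
  set S : Finset ℕ := (Finset.range P).filter (fun p => p.Prime ∧ p ≠ 2) with hS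
  set U : ℕ := ∏ p ∈ S, p ^ J p with hU
  refine ⟨U + 1, fun u hu huo hsm => ?_⟩
  have hu0 : u ≠ 0 := by omega
  by_contra hcon
  push Not at hcon
  have hlt : ∀ p ∈ u.primeFactors, u.factorization p ≤ J p := by
    intro p hp
    have hpp : p.Prime := Nat.prime_of_mem_primeFactors hp
    have hpu : p ∣ u := Nat.dvd_of_mem_primeFactors hp
    have hp2 : p ≠ 2 := by
      rintro rfl
      exact (Nat.not_even_iff_odd.mpr huo) (even_iff_two_dvd.mpr hpu)
    have hnot : ¬ p ^ J p ∣ u := fun hd => hcon (p ^ J p) hd (hJ p hpp hp2).1 (hJ p hpp hp2).2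
    rw [hpp.pow_dvd_iff_le_factorization hu0] at hnot
    omega
  have hsub : u.primeFactors ⊆ S := by
    intro p hp
    have hpp : p.Prime := Nat.prime_of_mem_primeFactors hp
    have hpu : p ∣ u := Nat.dvd_of_mem_primeFactors hp
    have hp2 : p ≠ 2 := by
      rintro rfl
      exact (Nat.not_even_iff_odd.mpr huo) (even_iff_two_dvd.mpr hpu)
    rw [hS, Finset.mem_filter, Finset.mem_range]
    exact ⟨hsm p hpp hpu, hpp, hp2⟩
  have h1 : u ≤ ∏ p ∈ u.primeFactors, p ^ J p := by
    calc u = ∏ p ∈ u.primeFactors, p ^ u.factorization p := Nat.prod_primeFactors_pow_factorization hu0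
      _ ≤ ∏ p ∈ u.primeFactors, p ^ J p :=
          Finset.prod_le_prod (fun p _ => Nat.zero_le _)
            (fun p hp => Nat.pow_le_pow_right (Nat.prime_of_mem_primeFactors hp).pos (hlt p hp))
  have h2 : ∏ p ∈ u.primeFactors, p ^ J p ≤ U := by
    refine Nat.le_of_dvd ?_ (Finset.prod_dvd_prod_of_subset _ _ _ hsub)
    rw [hU]
    exact Finset.prod_pos (fun p hp => pow_pos (by rw [hS, Finset.mem_filter] at hp; exact hp.2.1.pos) _)
  omega

/-- **THE DOOR ⟺ powers of two ∧ fold-free core ∧ finitely many prime-power certificates.** -/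
theorem covHard3_iff_certificates :
    WildDial.CovHard3 ↔
    (∀ D : ℕ, ∃ a₀ : ℕ, ∀ a ≥ a₀, 2 ^ a ∈ covLosing D) ∧
    (∀ D a : ℕ, ∃ p₀ : ℕ, ∀ p ≥ p₀, p.Prime → 2 ^ a * p ∈ covLosing D) ∧
    (∀ D a p : ℕ, p.Prime → p ≠ 2 → ∃ j : ℕ, 3 ≤ 2 ^ a * p ^ j ∧ 2 ^ a * p ^ j ∈ covLosing D) :=
  ⟨fun h => ⟨(lengths_of_covHard3 h).1, (lengths_of_covHard3 h).2.1, certificates_of_covHard3 h⟩,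
    fun h => covHard3_of_lengths h.1 h.2.1 (smoothNet_of_certificates h.2.2)⟩

end Summit.QuantumAdvantage.QuantumAdvantage.Theorems
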